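import Literature.Geometry.Kaehler.ComplexTorusAnalyticClassesRing
import Literature.Geometry.Kaehler.ComplexTorusWeilTypeHodgeRingOfSU
import Literature.Geometry.Kaehler.ComplexTorusWeilClassesFieldAction
import HarnessLib

/-!
# Analytic classes on an abelian variety of Weil type: `K^×`-stability, "all Weil classes are analytic
# or none is", and the Hodge conjecture for a Hodge-general `(X, K, E)` as the existence of ONE cycle

Layer `Literature/Geometry/Kaehler`, namespace `Literature.Geometry.Kaehler.ComplexTorus`; lane
`lit-hodgefound`, seat p07 (generation 35). Theorems only (no `def`, no named fact, no instance, no notation).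

Setting (torus level, the tree's `IsWeilType Φ α d n` / `IsPolarizedWeilType Φ η α d n`): `X = E/Φ(ℤ^ι)` of
dimension `2n`, `K = ℚ(α) ⊂ End_ℚ(X)`, `α² = -d`, the Weil–Hodge plane
`W_K = ⋀^{2n}_K H¹(X, ℚ) ⊂ H^{2n}(X, ℚ)` (`weilHodgeCycles Φ α d n`, a `ℚ`-plane), and the analytic classes
`Aᵖ(X) = analyticClasses Φ e p` (the `ℚ`-span of the fundamental classes of the closed analytic subsets of
codimension `p`; `e` an enumeration of the lattice basis).

* §1 **`f^* Aᵖ(X) ⊆ Aᵖ(X)` for every INVERTIBLE `f ∈ End_ℚ(X)`**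
  (`compContinuousLinearMap_analyticRepReal_mem_analyticClasses_of_isUnit`): write `N f = ρ(A)` with
  `A ∈ End(X)` an isogeny (Cor. 1.1.16 (b)); `ρ(A)^* Aᵖ ⊆ Aᵖ` (Fulton §1.7, the tree's
  `IsIsogeny.comp_realRep_mem_analyticClasses`) and `f^* = N^{-2p} ρ(A)^*` on `H^{2p}`.
* §2 **`K^×` acts on `Aᵖ(X)`** for `(X, K)` of Weil type (`IsWeilType.compContinuousLinearMap_fieldElt_mem_analyticClasses`):
  `f = q + pα ≠ 0` is invertible in `End_ℚ(X)` (`f · (q - pα) = q² + dp²`).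
* §3 **"Either all elements of `W_K` are analytic classes, or `0 ∈ W_K` is the only analytic class"**
  (`IsWeilType.weilHodgeCycles_le_analyticClasses_or_inf_eq_bot`) — Moonen–Zarhin's remark (2) ("Since
  `dim_F(W_F) = 1`, it readily follows that either all elements of `W_F` are Hodge classes, or `0 ∈ W_F` is
  the only Hodge class"), run for the `K^×`-stable subspace `Aⁿ(X) ∩ W_K` instead of `Bⁿ(X) ∩ W_K`: on
  `W_K ⊗ ℂ = ⋀^{2n} U₊ ⊕ ⋀^{2n} U₋`, `ρ(f)^*` acts by `(σ(f)^{2n}, σ̄(f)^{2n})`; a rational (hence real) class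
  `u = u₊ + u₋ ≠ 0` of `W_K` has `u₊ ≠ 0 ≠ u₋`; and some `f = t + α`, `t ∈ ℕ`, has `σ(f)^{2n} ≠ σ̄(f)^{2n}`
  (the polynomial `(X + √-d)^{2n} - (X - √-d)^{2n} ≠ 0` has degree `< 2n + 1`), so `u` and `ρ(f)^* u` are
  `ℚ`-independent in the plane `W_K`. No hypothesis on the Hodge group.
* §4 **Hodge-general `(X, K, E)`, `Hg(X) = SU_H` (Weil 1977; van Geemen Thm. 6.12: `Bᵖ = Dᵖ` for `p ≠ n`,
  `Bⁿ = Dⁿ ⊕ W_K`), `n ≥ 2`:** `Aᵖ(X) = Bᵖ(X)` for every `p ≠ n`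
  (`IsPolarizedWeilType.analyticClasses_eq_hodgeClasses_of_ne`); `Aⁿ(X) = Dⁿ(X)` or `Aⁿ(X) = Bⁿ(X)`
  (`IsPolarizedWeilType.analyticClasses_eq_divisorClasses_or_eq_hodgeClasses`); and **the Hodge conjecture for
  `X` (cycle form, all degrees) holds if and only if `X` contains a closed analytic subset of codimension `n`
  whose fundamental class is not a rational multiple of `c₁(L)^{∧n}`**, iff one non-zero Weil class is
  analytic (`IsPolarizedWeilType.forall_analyticClasses_eq_hodgeClasses_iff_exists_not_mem_divisorClasses`,
  `…_iff_exists_mem_weilHodgeCycles`). This is the form in which Schoen (1988) and van Geemen (1996) verify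
  the conjecture for general Weil fourfolds with `K = ℚ(√-3), ℚ(i)` (van Geemen 1994, Thm. 4.15, §7: "cycle
  classes that span the space of Weil-Hodge cycles"); by §3 one class with non-zero Weil component suffices.

## References

* [MoonenZarhin1998WeilClasses] B. J. J. Moonen, Yu. G. Zarhin, *Weil classes on abelian varieties*, J. reine
  angew. Math. 496 (1998), (2) (arXiv alg-geom/9612017, p. 1).
* [vanGeemen1994HodgeAV] B. van Geemen, *An introduction to the Hodge conjecture for abelian varieties*, in:
  Algebraic Cycles and Hodge Theory (Torino 1993), LNM 1594, Springer 1994: 4.9–4.11, Thm. 4.15, Thm. 6.12, §7.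
* [Weil1977HodgeRing] A. Weil, *Abelian varieties and the Hodge ring* [1977c], Œuvres III, 421–429.
* [Lange2023AbelianVarietiesComplex] H. Lange, *Abelian Varieties over the Complex Numbers*, Springer 2023,
  §1.1.2 Cor. 1.1.16 (b), §7.2.4 Exercises (9)–(10), §7.3.1 (p. 336), §7.3.3 Exercise (1).
* [Fulton1998] W. Fulton, *Intersection Theory*, 2nd ed., Springer 1998, §1.7.
-/

noncomputable section

open scoped Manifold
open Module Set Function Polynomial
open Literature.Analysis.Complex Literature.Analysis.Complex.WeilOperator Literature.LinearAlgebra.Alternating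

universe u

namespace Literature.Geometry.Kaehler

namespace ComplexTorus

/-! ### §0 Two lemmas on forms -/

section Forms

variable {E : Type*} [NormedAddCommGroup E] [NormedSpace ℂ E]

/-- `γ ∘ (c M)^{⊗k} = cᵏ · (γ ∘ M^{⊗k})` for a real scalar `c`. [folklore] -/
private theorem compContinuousLinearMap_smul_eq {k : ℕ} (γ : E [⋀^Fin k]→L[ℝ] ℂ) (c : ℝ) (M : E →L[ℝ] E) :
    γ.compContinuousLinearMap (c • M) = ((c ^ k : ℝ) : ℂ) • γ.compContinuousLinearMap M := by
  ext v
  rw [ContinuousAlternatingMap.compContinuousLinearMap_apply, ContinuousAlternatingMap.smul_apply,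
    ContinuousAlternatingMap.compContinuousLinearMap_apply]
  have h := γ.map_smul_univ (fun _ : Fin k ↦ c) (⇑M ∘ v)
  simp only [Finset.prod_const, Finset.card_univ, Fintype.card_fin, comp_apply] at h
  have hc : (⇑(c • M) ∘ v) = fun i ↦ c • M (v i) := rfl
  rw [hc, h, Complex.real_smul, Complex.ofReal_pow, smul_eq_mul]

/-- **A REAL form in a slot-eigenspace `⋀ᵏ U_c(T)` with `c̄ ≠ c` vanishes** (`k ≥ 1`): applying complex
conjugation to `γ(Tv₀, v₁, …) = c γ(v₀, v₁, …)` gives `c γ(v) = c̄ γ(v)`. [folklore] -/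
private theorem eq_zero_of_mem_slotEigenForms_of_conjForm_eq {T : E →L[ℝ] E} {c : ℂ}
    (hc : starRingEnd ℂ c ≠ c) {k : ℕ} (hk : 0 < k) {γ : E [⋀^Fin k]→L[ℝ] ℂ}
    (hγ : γ ∈ slotEigenForms T c k) (hreal : conjForm γ = γ) : γ = 0 := by
  ext v
  have h1 := hγ v ⟨0, hk⟩
  have hr : ∀ w, starRingEnd ℂ (γ w) = γ w := fun w ↦ by
    rw [← conjForm_apply, hreal]
  have h2 := congrArg (starRingEnd ℂ) h1
  rw [hr, map_mul, hr, h1] at h2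
  -- `h2 : c * γ v = conj c * γ v`
  have h3 : (c - starRingEnd ℂ c) * γ v = 0 := by rw [sub_mul, h2, sub_self]
  rcases mul_eq_zero.1 h3 with h | h
  · exact absurd (sub_eq_zero.1 h).symm hc
  · rw [h]
    rfl

/-- **Some `f = t + √-d`, `t ∈ ℕ`, has `σ(f)^{m} ≠ σ̄(f)^{m}`** (`√-d ≠ 0`, `m ≥ 1`): the polynomial
`(X + a)^m - (X - a)^m` has coefficient `2ma ≠ 0` at `X^{m-1}` and degree `< m + 1`, so it does not vanish at
all of `0, 1, …, m`. [folklore] -/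
private theorem exists_nat_add_pow_ne_sub_pow {a : ℂ} (ha : a ≠ 0) {m : ℕ} (hm : 0 < m) :
    ∃ t : ℕ, ((t : ℂ) + a) ^ m ≠ ((t : ℂ) - a) ^ m := by
  by_contra! hall
  set D : Polynomial ℂ :=
    (Polynomial.X + Polynomial.C a) ^ m - (Polynomial.X + Polynomial.C (-a)) ^ m with hD
  have heval : ∀ t : Fin (m + 1), D.eval ((t : ℕ) : ℂ) = 0 := fun t ↦ by
    rw [hD, Polynomial.eval_sub, Polynomial.eval_pow, Polynomial.eval_pow, Polynomial.eval_add,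
      Polynomial.eval_add, Polynomial.eval_X, Polynomial.eval_C, Polynomial.eval_C, ← sub_eq_add_neg,
      hall t, sub_self]
  have hinj : Function.Injective (fun t : Fin (m + 1) ↦ ((t : ℕ) : ℂ)) := fun i j hij ↦ by
    dsimp only at hij
    exact Fin.ext (by exact_mod_cast hij)
  have hdeg : D.natDegree < Fintype.card (Fin (m + 1)) := by
    rw [Fintype.card_fin, Nat.lt_succ_iff, hD]
    refine (Polynomial.natDegree_sub_le _ _).trans (max_le ?_ ?_) <;>
      exact Polynomial.natDegree_pow_le.trans (by rw [Polynomial.natDegree_X_add_C, mul_one])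
  have hD0 : D = 0 := Polynomial.eq_zero_of_natDegree_lt_card_of_eval_eq_zero D hinj heval hdeg
  have hcoeff : D.coeff (m - 1) = 2 * (m : ℂ) * a := by
    rw [hD, Polynomial.coeff_sub, Polynomial.coeff_X_add_C_pow, Polynomial.coeff_X_add_C_pow,
      Nat.sub_sub_self (Nat.one_le_of_lt hm), pow_one, pow_one, Nat.choose_symm (Nat.one_le_of_lt hm),
      Nat.choose_one_right]
    ring
  rw [hD0, Polynomial.coeff_zero] at hcoeff
  have hm0 : (m : ℂ) ≠ 0 := Nat.cast_ne_zero.2 hm.ne'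
  exact absurd hcoeff.symm (mul_ne_zero (mul_ne_zero two_ne_zero hm0) ha)

end Forms

/-! ### §1 Invertible rational endomorphisms act on `Aᵖ(X)` -/

section UnitPullback

variable {ι : Type*} [Fintype ι] [DecidableEq ι] {E : Type u} [NormedAddCommGroup E] [InnerProductSpace ℂ E]
  [FiniteDimensional ℂ E] [MeasurableSpace E] [BorelSpace E] (Φ : (ι → ℝ) ≃L[ℝ] E) {N : ℕ} (e : Fin N ≃ ι)

/-- **`f^* Aᵖ(X) ⊆ Aᵖ(X)` for an invertible `f ∈ End_ℚ(X)`** (a rational matrix `β ∈ End_ℚ(X)` which is a unit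
of `M_ι(ℚ)`, hence of `End_ℚ(X)`): for `N ≥ 1` with `Nβ = A` integral, `ρ(A)` is an isogeny of `X` ("an
element in `End(X)` is an isogeny if and only if it is invertible in `End_ℚ(X)`", Cor. 1.1.16 (b)), `ρ(A)^*`
preserves `Aᵖ(X)` (pull-back of cycles along an isogeny, `ρ(A)^*[Z] = ± [ρ(A)⁻¹ Z]`), and `β^* = N^{-2p} ρ(A)^*`
on `H^{2p}(X)`. [cite: Lange2023AbelianVarietiesComplex, §1.1.2 Cor. 1.1.16 (b) and §7.3.3 Exercise (1) (p. 341)]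
[cite: Fulton1998, §1.7] -/
theorem compContinuousLinearMap_analyticRepReal_mem_analyticClasses_of_isUnit {β : Matrix ι ι ℚ}
    (hβ : β ∈ endAlgRat Φ) (hu : IsUnit β) {p : ℕ} {γ : E [⋀^Fin (2 * p)]→L[ℝ] ℂ}
    (hγ : γ ∈ analyticClasses Φ e p) :
    γ.compContinuousLinearMap (analyticRepReal Φ Φ (β.map (Rat.cast : ℚ → ℝ))) ∈ analyticClasses Φ e p := by
  obtain ⟨d₀, hd₀, A, hA⟩ := exists_intMatrix_map_eq_smul β
  have hA' : A.map (Int.cast : ℤ → ℚ) = (d₀ : ℚ) • β := by rw [hA, Int.cast_smul_eq_zsmul]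
  have hAend : A.map (Int.cast : ℤ → ℚ) ∈ endAlgRat Φ := by
    rw [hA]
    exact zsmul_mem hβ d₀
  have hAunit : IsUnit (A.map (Int.cast : ℤ → ℚ)) := by
    rw [hA', Matrix.isUnit_iff_isUnit_det, Matrix.det_smul, isUnit_iff_ne_zero]
    exact mul_ne_zero (pow_ne_zero _ (Int.cast_ne_zero.2 hd₀)) ((Matrix.isUnit_iff_isUnit_det β).1 hu).ne_zero
  have hiso : IsIsogeny Φ Φ A :=
    (isIsogeny_iff_isUnit_endAlgRat Φ hAend).2 ((isUnit_endAlgRat_iff Φ ⟨_, hAend⟩).2 hAunit)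
  have hmem := hiso.comp_realRep_mem_analyticClasses Φ Φ e e hγ
  have hAr : A.map (Int.cast : ℤ → ℝ) = (d₀ : ℝ) • β.map (Rat.cast : ℚ → ℝ) := by
    ext i j
    have hij := congrFun (congrFun hA' i) j
    simp only [Matrix.map_apply, Matrix.smul_apply, smul_eq_mul] at hij ⊢
    rw [← Rat.cast_intCast (α := ℝ) (A i j), hij, Rat.cast_mul, Rat.cast_intCast]
  have hrep : realRep Φ Φ A = (d₀ : ℝ) • analyticRepReal Φ Φ (β.map (Rat.cast : ℚ → ℝ)) := by
    rw [realRep_eq_analyticRepReal, hAr, analyticRepReal_smul]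
  rw [hrep, compContinuousLinearMap_smul_eq] at hmem
  have hq : (((d₀ : ℝ) ^ (2 * p) : ℝ) : ℂ) = (((d₀ : ℚ) ^ (2 * p) : ℚ) : ℂ) := by push_cast; rfl
  rw [hq, Rat.cast_smul_eq_qsmul] at hmem
  have hne : ((d₀ : ℚ) ^ (2 * p)) ≠ 0 := pow_ne_zero _ (Int.cast_ne_zero.2 hd₀)
  have h2 := (analyticClasses Φ e p).smul_mem ((d₀ : ℚ) ^ (2 * p))⁻¹ hmem
  rwa [smul_smul, inv_mul_cancel₀ hne, one_smul] at h2

end UnitPullback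

/-! ### §2 `K^×` acts on `Aᵖ(X)` for `(X, K)` of Weil type -/

section FieldAction

variable {ι : Type*} [Fintype ι] [DecidableEq ι] {E : Type u} [NormedAddCommGroup E] [InnerProductSpace ℂ E]
  [FiniteDimensional ℂ E] [MeasurableSpace E] [BorelSpace E] (Φ : (ι → ℝ) ≃L[ℝ] E) {N : ℕ} (e : Fin N ≃ ι)
  {α : Matrix ι ι ℚ} {d n : ℕ}

/-- `(q + pα)(q - pα) = (q² + dp²)·1` for `α² = -d`. [cite: vanGeemen1994HodgeAV, 4.9] -/
private theorem fieldElt_mul_conj (hsq : α * α = -((d : ℚ) • 1)) (q p : ℚ) :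
    (q • (1 : Matrix ι ι ℚ) + p • α) * (q • (1 : Matrix ι ι ℚ) + (-p) • α) =
      (q ^ 2 + (d : ℚ) * p ^ 2) • (1 : Matrix ι ι ℚ) := by
  rw [Matrix.add_mul, Matrix.mul_add, Matrix.mul_add, Matrix.smul_mul, Matrix.smul_mul, Matrix.smul_mul,
    Matrix.smul_mul, Matrix.mul_smul, Matrix.mul_smul, Matrix.mul_smul, Matrix.mul_smul, Matrix.one_mul,
    Matrix.one_mul, Matrix.mul_one, hsq]
  ext i j
  simp only [Matrix.add_apply, Matrix.smul_apply, Matrix.neg_apply, Matrix.one_apply, smul_eq_mul]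
  split_ifs <;> ring

omit [FiniteDimensional ℂ E] [MeasurableSpace E] [BorelSpace E] in
/-- **A non-zero element `f = q + pα` of `K = ℚ(α) ⊂ End_ℚ(X)` is invertible** (`α² = -d < 0`,
`f · (q - pα) = q² + dp² ≠ 0`). [cite: vanGeemen1994HodgeAV, 4.9] [cite: Lange2023AbelianVarietiesComplex, §1.1.2 Cor. 1.1.16 (b)] -/
theorem IsWeilType.isUnit_fieldElt (h : IsWeilType Φ α d n) {q p : ℚ} (hqp : q ≠ 0 ∨ p ≠ 0) :
    IsUnit (q • (1 : Matrix ι ι ℚ) + p • α) := by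
  have hm : q ^ 2 + (d : ℚ) * p ^ 2 ≠ 0 := by
    have hd : (0 : ℚ) < d := by exact_mod_cast h.pos
    rcases hqp with hq | hp
    · exact ne_of_gt (add_pos_of_pos_of_nonneg (sq_pos_of_ne_zero hq) (mul_nonneg hd.le (sq_nonneg p)))
    · exact ne_of_gt (add_pos_of_nonneg_of_pos (sq_nonneg q) (mul_pos hd (sq_pos_of_ne_zero hp)))
  rw [Matrix.isUnit_iff_isUnit_det]
  refine Matrix.isUnit_det_of_right_inverse
    (B := (q ^ 2 + (d : ℚ) * p ^ 2)⁻¹ • (q • (1 : Matrix ι ι ℚ) + (-p) • α)) ?_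
  rw [Matrix.mul_smul, fieldElt_mul_conj h.mul_self, smul_smul, inv_mul_cancel₀ hm, one_smul]

omit [FiniteDimensional ℂ E] [MeasurableSpace E] [BorelSpace E] in
/-- `f = q + pα ∈ End_ℚ(X)`. [cite: vanGeemen1994HodgeAV, 4.9] -/
theorem IsWeilType.fieldElt_mem_endAlgRat (h : IsWeilType Φ α d n) (q p : ℚ) :
    q • (1 : Matrix ι ι ℚ) + p • α ∈ endAlgRat Φ :=
  add_mem ((endAlgRat Φ).smul_mem (one_mem _) q) ((endAlgRat Φ).smul_mem h.mem_endAlgRat p)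

/-- **`K^×` acts on the analytic classes: `ρ(f)^* Aᵖ(X) ⊆ Aᵖ(X)` for `f = q + pα ≠ 0` in `K = ℚ(α)`**
(`(X, K)` of Weil type) — the analytic counterpart of "the multiplicative group `F^*` acts on
`⊕ H^i(X, ℚ) ⊃ B•(X) ⊇ D•(X)`". [cite: MoonenZarhin1998WeilClasses, (2)] [cite: Fulton1998, §1.7]
[cite: Lange2023AbelianVarietiesComplex, §1.1.2 Cor. 1.1.16 (b)] -/
theorem IsWeilType.compContinuousLinearMap_fieldElt_mem_analyticClasses (h : IsWeilType Φ α d n) {q p : ℚ}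
    (hqp : q ≠ 0 ∨ p ≠ 0) {k : ℕ} {γ : E [⋀^Fin (2 * k)]→L[ℝ] ℂ} (hγ : γ ∈ analyticClasses Φ e k) :
    γ.compContinuousLinearMap
        (analyticRepReal Φ Φ ((q • (1 : Matrix ι ι ℚ) + p • α).map (Rat.cast : ℚ → ℝ))) ∈
      analyticClasses Φ e k :=
  compContinuousLinearMap_analyticRepReal_mem_analyticClasses_of_isUnit Φ e (h.fieldElt_mem_endAlgRat Φ q p)
    (h.isUnit_fieldElt Φ hqp) hγ

end FieldAction

/-! ### §3 Either all Weil classes are analytic, or none but `0` is -/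

section Dichotomy

variable {ι : Type*} [Fintype ι] [DecidableEq ι] {E : Type u} [NormedAddCommGroup E] [InnerProductSpace ℂ E]
  [FiniteDimensional ℂ E] [MeasurableSpace E] [BorelSpace E] (Φ : (ι → ℝ) ≃L[ℝ] E) {N : ℕ} (e : Fin N ≃ ι)
  {α : Matrix ι ι ℚ} {d n : ℕ}

/-- **"Either all elements of `W_K` are analytic classes, or `0 ∈ W_K` is the only analytic class"** for a
complex torus `(X, K)` of Weil type (Moonen–Zarhin's remark (2), stated there for Hodge classes, applied to the
`K^×`-stable `ℚ`-subspace `Aⁿ(X) ∩ W_K` of the `K`-line `W_K`): `W_K ⊆ Aⁿ(X)` or `W_K ∩ Aⁿ(X) = 0`. On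
`W_K ⊗ ℂ = ⋀^{2n} U₊ ⊕ ⋀^{2n} U₋` the pull-back `ρ(f)^*`, `f = t + α`, acts by `(σ(f)^{2n}, σ̄(f)^{2n})`; a
non-zero rational class `u = u₊ + u₋ ∈ W_K` has both components non-zero (it is real), and for `t ∈ ℕ` with
`σ(f)^{2n} ≠ σ̄(f)^{2n}` the analytic classes `u`, `ρ(f)^* u` span the plane `W_K`.
[cite: MoonenZarhin1998WeilClasses, (2)] [cite: vanGeemen1994HodgeAV, 4.9 (`dim_ℚ ⋀^{2n}_K H¹(X, ℚ) = 2`)] -/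
theorem IsWeilType.weilHodgeCycles_le_analyticClasses_or_inf_eq_bot (h : IsWeilType Φ α d n) :
    weilHodgeCycles Φ α d n ≤ analyticClasses Φ e n ∨ weilHodgeCycles Φ α d n ⊓ analyticClasses Φ e n = ⊥ := by
  classical
  rw [or_iff_not_imp_right]
  intro hne
  obtain ⟨u, hu, hu0⟩ := (Submodule.ne_bot_iff _).1 hne
  obtain ⟨huW, huA⟩ := Submodule.mem_inf.1 hu
  -- the decomposition `u = u₊ + u₋` and the action of `K`
  obtain ⟨up, hup, um, hum, hsum, hact⟩ := exists_add_eq_of_mem_weilHodgeCycles huW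
  set T := analyticRepReal Φ Φ (α.map (Rat.cast : ℚ → ℝ)) with hT
  have hdpos : (0 : ℝ) < d := h.pos_real
  have hk : 0 < 2 * n := h.degree_pos
  have hdisj := disjoint_slotEigenForms (T := T) (sqrtNeg_ne_neg hdpos) hk
  -- `u` is real, hence `u₊ ≠ 0` and `u₋ ≠ 0`
  have hreal : conjForm u = u := conjForm_eq_self_of_mem_rationalForms Φ (weilHodgeCycles_le_rationalForms Φ α d n huW)
  have hcp : starRingEnd ℂ (sqrtNeg d) ≠ sqrtNeg d := by
    rw [conj_sqrtNeg]; exact (sqrtNeg_ne_neg hdpos).symm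
  have hcm : starRingEnd ℂ (-sqrtNeg d) ≠ -sqrtNeg d := by
    rw [map_neg, conj_sqrtNeg, neg_neg]; exact sqrtNeg_ne_neg hdpos
  have hup0 : up ≠ 0 := by
    intro h0
    rw [h0, zero_add] at hsum
    rw [← hsum] at hreal hu0
    exact hu0 (eq_zero_of_mem_slotEigenForms_of_conjForm_eq hcm hk hum hreal)
  have hum0 : um ≠ 0 := by
    intro h0
    rw [h0, add_zero] at hsum
    rw [← hsum] at hreal hu0
    exact hu0 (eq_zero_of_mem_slotEigenForms_of_conjForm_eq hcp hk hup hreal)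
  -- an `f = t + α` with `σ(f)^{2n} ≠ σ̄(f)^{2n}`
  obtain ⟨t, ht⟩ := exists_nat_add_pow_ne_sub_pow (sqrtNeg_ne_zero hdpos) hk
  set lam : ℂ := ((t : ℂ) + sqrtNeg d) ^ (2 * n) with hlam
  set mu : ℂ := ((t : ℂ) - sqrtNeg d) ^ (2 * n) with hmu
  set v := u.compContinuousLinearMap
    (analyticRepReal Φ Φ ((((t : ℚ)) • (1 : Matrix ι ι ℚ) + (1 : ℚ) • α).map (Rat.cast : ℚ → ℝ))) with hv
  have hvact : v = lam • up + mu • um := by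
    rw [hv, hact (t : ℚ) 1]
    simp only [Rat.cast_natCast, Rat.cast_one, one_mul, hlam, hmu]
  have hvW : v ∈ weilHodgeCycles Φ α d n := fieldElt_compContinuousLinearMap_mem_weilHodgeCycles (t : ℚ) 1 huW
  have hvA : v ∈ analyticClasses Φ e n :=
    h.compContinuousLinearMap_fieldElt_mem_analyticClasses Φ e (Or.inr one_ne_zero) huA
  -- `u`, `v` are `ℚ`-independent
  have hlin : LinearIndependent ℚ ![u, v] := by
    refine LinearIndependent.pair_iff.2 fun s r hsr ↦ ?_
    have hsr' : ((s : ℂ) + (r : ℂ) * lam) • up + ((s : ℂ) + (r : ℂ) * mu) • um = 0 := by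
      have h0 : (s : ℂ) • u + (r : ℂ) • v = 0 := by
        rw [Rat.cast_smul_eq_qsmul, Rat.cast_smul_eq_qsmul]
        exact hsr
      rw [hvact, ← hsum] at h0
      linear_combination (norm := module) h0
    -- both coefficients vanish (the sum `⋀ U₊ ⊕ ⋀ U₋` is direct)
    have hp_mem : ((s : ℂ) + (r : ℂ) * lam) • up ∈ slotEigenForms T (sqrtNeg d) (2 * n) :=
      Submodule.smul_mem _ _ hup
    have hm_mem : ((s : ℂ) + (r : ℂ) * lam) • up ∈ slotEigenForms T (-sqrtNeg d) (2 * n) := by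
      have : ((s : ℂ) + (r : ℂ) * lam) • up = -(((s : ℂ) + (r : ℂ) * mu) • um) := eq_neg_of_add_eq_zero_left hsr'
      rw [this]
      exact Submodule.neg_mem _ (Submodule.smul_mem _ _ hum)
    have hzero := (Submodule.disjoint_def.1 hdisj) _ hp_mem hm_mem
    have hc1 : (s : ℂ) + (r : ℂ) * lam = 0 := by
      by_contra hc
      exact hup0 ((smul_eq_zero.1 hzero).resolve_left hc)
    rw [hzero, zero_add] at hsr'
    have hc2 : (s : ℂ) + (r : ℂ) * mu = 0 := by
      by_contra hc
      exact hum0 ((smul_eq_zero.1 hsr').resolve_left hc)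
    have hr : (r : ℂ) = 0 := by
      have hsub : (r : ℂ) * (lam - mu) = 0 := by rw [mul_sub, ← sub_eq_zero.2 rfl]; linear_combination hc1 - hc2
      exact (mul_eq_zero.1 hsub).resolve_right (sub_ne_zero.2 ht)
    have hs : (s : ℂ) = 0 := by rw [hr, zero_mul, add_zero] at hc1; exact hc1
    exact ⟨by exact_mod_cast hs, by exact_mod_cast hr⟩
  -- dimension count inside the plane `W_K`
  haveI : FiniteDimensional ℚ (hodgeClasses Φ n) := finiteDimensional_hodgeClassesIn Φ (2 * n) n
  haveI : FiniteDimensional ℚ (weilHodgeCycles Φ α d n) :=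
    Submodule.finiteDimensional_of_le h.weilHodgeCycles_le_hodgeClasses
  have hle : weilHodgeCycles Φ α d n ⊓ analyticClasses Φ e n ≤ weilHodgeCycles Φ α d n := inf_le_left
  have h2 : 2 ≤ finrank ℚ (weilHodgeCycles Φ α d n ⊓ analyticClasses Φ e n : Submodule ℚ _) := by
    have hsub : Submodule.span ℚ (Set.range ![u, v]) ≤ weilHodgeCycles Φ α d n ⊓ analyticClasses Φ e n := by
      rw [Submodule.span_le]
      rintro _ ⟨i, rfl⟩
      fin_cases i
      · exact hu
      · exact Submodule.mem_inf.2 ⟨hvW, hvA⟩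
    haveI : FiniteDimensional ℚ (weilHodgeCycles Φ α d n ⊓ analyticClasses Φ e n : Submodule ℚ _) :=
      Submodule.finiteDimensional_of_le hle
    calc 2 = Fintype.card (Fin 2) := (Fintype.card_fin 2).symm
      _ = finrank ℚ (Submodule.span ℚ (Set.range ![u, v])) := (finrank_span_eq_card hlin).symm
      _ ≤ _ := Submodule.finrank_mono hsub
  have heq : weilHodgeCycles Φ α d n ⊓ analyticClasses Φ e n = weilHodgeCycles Φ α d n :=
    Submodule.eq_of_le_of_finrank_le hle (by rw [h.finrank_weilHodgeCycles]; exact h2)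
  exact inf_eq_left.1 heq

/-- **One non-zero analytic Weil class makes all Weil classes analytic.** [cite: MoonenZarhin1998WeilClasses, (2)] -/
theorem IsWeilType.weilHodgeCycles_le_analyticClasses_of_mem (h : IsWeilType Φ α d n)
    {w : E [⋀^Fin (2 * n)]→L[ℝ] ℂ} (hw : w ∈ weilHodgeCycles Φ α d n) (hwA : w ∈ analyticClasses Φ e n)
    (hw0 : w ≠ 0) : weilHodgeCycles Φ α d n ≤ analyticClasses Φ e n :=
  (h.weilHodgeCycles_le_analyticClasses_or_inf_eq_bot Φ e).resolve_right fun hbot ↦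
    hw0 ((Submodule.mem_bot ℚ).1 (hbot ▸ Submodule.mem_inf.2 ⟨hw, hwA⟩))

end Dichotomy

/-! ### §4 Hodge-general abelian varieties of Weil type: `Hg(X) = SU_H` -/

section General

variable {ι : Type*} [Fintype ι] [DecidableEq ι] {E : Type u} [NormedAddCommGroup E] [InnerProductSpace ℂ E]
  [FiniteDimensional ℂ E] [MeasurableSpace E] [BorelSpace E] (Φ : (ι → ℝ) ≃L[ℝ] E) {N : ℕ} (e : Fin N ≃ ι)
  {η : E [⋀^Fin 2]→L[ℝ] ℝ} {α : Matrix ι ι ℚ} {d n : ℕ}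

/-- **`Aᵖ(X) = Bᵖ(X)` for every `p ≠ n`** on a `2n`-dimensional polarised abelian variety of Weil type with
`Hg(X) ⊇ SU_H(ℝ)` (`n ≥ 2`): off the middle degree `Bᵖ(X) = Dᵖ(X) = ℚ · E^{∧p}` (van Geemen, Thm. 6.12) and
`Dᵖ(X) ⊆ Aᵖ(X)` ("the cycle classes in `D•` are all algebraic"). [cite: vanGeemen1994HodgeAV, Thm. 6.12]
[cite: Lange2023AbelianVarietiesComplex, §7.3.1 (p. 336) and §7.2.4 Exercise (10)] -/
theorem IsPolarizedWeilType.analyticClasses_eq_hodgeClasses_of_ne (h : IsPolarizedWeilType Φ η α d n)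
    (hHg : weilSpecialUnitaryGroup Φ η α d n ≤ hodgeGroup Φ) (hn : 2 ≤ n) {p : ℕ} (hp : p ≠ n) :
    analyticClasses Φ e p = hodgeClasses Φ p := by
  by_cases hpn : p ≤ 2 * n
  · exact IsAbelianVariety.analyticClasses_eq_hodgeClasses_of_divisorClasses_eq Φ e ⟨η, h.isRiemannForm⟩
      (h.hodgeClasses_eq_divisorClasses_of_weilSpecialUnitaryGroup_le hHg hn hp hpn).symm
  · exact analyticClasses_eq_hodgeClasses_of_finrank_lt Φ e (by rw [h.finrank_eq]; omega)

/-- **`Aⁿ(X) = Dⁿ(X)` or `Aⁿ(X) = Bⁿ(X)`** in the middle degree of a Hodge-general polarised abelian variety of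
Weil type (`n ≥ 2`): `Bⁿ = Dⁿ ⊕ W_K` (Thm. 6.12), `Dⁿ ⊆ Aⁿ ⊆ Bⁿ`, and by §3 `W_K ⊆ Aⁿ` or `W_K ∩ Aⁿ = 0`
(modular law). [cite: vanGeemen1994HodgeAV, Thm. 6.12] [cite: MoonenZarhin1998WeilClasses, (2)]
[cite: Lange2023AbelianVarietiesComplex, §7.3.1 (p. 336)] -/
theorem IsPolarizedWeilType.analyticClasses_eq_divisorClasses_or_eq_hodgeClasses (h : IsPolarizedWeilType Φ η α d n)
    (hHg : weilSpecialUnitaryGroup Φ η α d n ≤ hodgeGroup Φ) (hn : 2 ≤ n) :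
    analyticClasses Φ e n = divisorClasses Φ n ∨ analyticClasses Φ e n = hodgeClasses Φ n := by
  have hB := h.hodgeClasses_eq_divisorClasses_sup_weilHodgeCycles_of_weilSpecialUnitaryGroup_le hHg hn
  have hDA : divisorClasses Φ n ≤ analyticClasses Φ e n :=
    IsAbelianVariety.divisorClasses_le_analyticClasses Φ e ⟨η, h.isRiemannForm⟩ n
  have hAB : analyticClasses Φ e n ≤ hodgeClasses Φ n := analyticClasses_le_hodgeClasses Φ e n
  rcases h.toIsWeilType.weilHodgeCycles_le_analyticClasses_or_inf_eq_bot Φ e with hW | hW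
  · right
    exact le_antisymm hAB (hB ▸ sup_le hDA hW)
  · left
    have hmod : (divisorClasses Φ n ⊔ weilHodgeCycles Φ α d n) ⊓ analyticClasses Φ e n =
        divisorClasses Φ n ⊔ weilHodgeCycles Φ α d n ⊓ analyticClasses Φ e n := sup_inf_assoc_of_le _ hDA
    rw [hW, sup_bot_eq, ← hB, inf_eq_right.2 hAB] at hmod
    exact hmod

/-- **The Hodge conjecture for a Hodge-general abelian variety of Weil type ⟺ the Weil classes are analytic**:
`Aᵖ(X) = Bᵖ(X)` for all `p` iff `W_K ⊆ Aⁿ(X)` (`n ≥ 2`). [cite: vanGeemen1994HodgeAV, Thm. 6.12 and Thm. 4.11]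
[cite: Lange2023AbelianVarietiesComplex, §7.3.1 (p. 336)] -/
theorem IsPolarizedWeilType.forall_analyticClasses_eq_hodgeClasses_iff_weilHodgeCycles_le
    (h : IsPolarizedWeilType Φ η α d n) (hHg : weilSpecialUnitaryGroup Φ η α d n ≤ hodgeGroup Φ) (hn : 2 ≤ n) :
    (∀ p, analyticClasses Φ e p = hodgeClasses Φ p) ↔ weilHodgeCycles Φ α d n ≤ analyticClasses Φ e n := by
  constructor
  · intro hall
    rw [hall n]
    exact h.toIsWeilType.weilHodgeCycles_le_hodgeClasses
  · intro hW p
    by_cases hp : p = n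
    · subst hp
      refine le_antisymm (analyticClasses_le_hodgeClasses Φ e p) ?_
      rw [h.hodgeClasses_eq_divisorClasses_sup_weilHodgeCycles_of_weilSpecialUnitaryGroup_le hHg hn]
      exact sup_le (IsAbelianVariety.divisorClasses_le_analyticClasses Φ e ⟨η, h.isRiemannForm⟩ p) hW
    · exact h.analyticClasses_eq_hodgeClasses_of_ne Φ e hHg hn hp

/-- **… ⟺ ONE non-zero Weil class is analytic** (`n ≥ 2`; by §3 one class gives all).
[cite: MoonenZarhin1998WeilClasses, (2)] [cite: vanGeemen1994HodgeAV, Thm. 6.12] -/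
theorem IsPolarizedWeilType.forall_analyticClasses_eq_hodgeClasses_iff_exists_mem_weilHodgeCycles
    (h : IsPolarizedWeilType Φ η α d n) (hHg : weilSpecialUnitaryGroup Φ η α d n ≤ hodgeGroup Φ) (hn : 2 ≤ n) :
    (∀ p, analyticClasses Φ e p = hodgeClasses Φ p) ↔
      ∃ w ∈ weilHodgeCycles Φ α d n, w ≠ 0 ∧ w ∈ analyticClasses Φ e n := by
  rw [h.forall_analyticClasses_eq_hodgeClasses_iff_weilHodgeCycles_le Φ e hHg hn]
  constructor
  · intro hW
    obtain ⟨w, hw, hw0⟩ := (Submodule.ne_bot_iff _).1 h.toIsWeilType.weilHodgeCycles_ne_bot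
    exact ⟨w, hw, hw0, hW hw⟩
  · rintro ⟨w, hw, hw0, hwA⟩
    exact h.toIsWeilType.weilHodgeCycles_le_analyticClasses_of_mem Φ e hw hwA hw0

/-- **THE HODGE CONJECTURE FOR A HODGE-GENERAL ABELIAN VARIETY OF WEIL TYPE IS EQUIVALENT TO THE EXISTENCE OF
ONE CLOSED ANALYTIC SUBSET OF CODIMENSION `n` WHOSE FUNDAMENTAL CLASS IS NOT IN `Dⁿ(X) = ℚ · c₁(L)^{∧n}`**
(`dim X = 2n`, `n ≥ 2`, `Hg(X) ⊇ SU_H(ℝ)`; `2n + 2n = rk Λ`): `Aᵖ(X) = Bᵖ(X)` for all `p` iff some closed analytic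
`Z ⊆ X` of pure dimension `n` has `[Z] ∉ Dⁿ(X)`. (`⟹`: `Aⁿ = Bⁿ ≠ Dⁿ` is spanned by such classes; `⟸`: `[Z] ∈ Aⁿ`
rules out `Aⁿ = Dⁿ` in the dichotomy.) This is the form in which the conjecture is verified for the general Weil
fourfolds with `K = ℚ(√-3)`, `ℚ(i)`, `det H = 1` (Schoen; van Geemen, Thm. 4.15 and §7).
[cite: vanGeemen1994HodgeAV, Thm. 4.11, Thm. 4.15, Thm. 6.12 and §7] [cite: MoonenZarhin1998WeilClasses, (2)]
[cite: Lange2023AbelianVarietiesComplex, §7.3.1 (p. 336)] -/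
theorem IsPolarizedWeilType.forall_analyticClasses_eq_hodgeClasses_iff_exists_not_mem_divisorClasses
    (h : IsPolarizedWeilType Φ η α d n) (hHg : weilSpecialUnitaryGroup Φ η α d n ≤ hodgeGroup Φ) (hn : 2 ≤ n)
    (hN : 2 * n + 2 * n = N) :
    (∀ p, analyticClasses Φ e p = hodgeClasses Φ p) ↔
      ∃ (Z : Set (ComplexTorus Φ)) (hZ : HasPureDim 𝓘(ℂ, E) Z n), analyticCycleClass Φ e hN hZ ∉ divisorClasses Φ n := by
  have hDB : divisorClasses Φ n ≠ hodgeClasses Φ n := by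
    intro hDB
    have hbot := h.divisorClasses_inf_weilHodgeCycles_eq_bot_of_weilSpecialUnitaryGroup_le hHg hn
    rw [hDB, inf_eq_right.2 h.toIsWeilType.weilHodgeCycles_le_hodgeClasses] at hbot
    exact h.toIsWeilType.weilHodgeCycles_ne_bot hbot
  constructor
  · intro hall
    by_contra! hno
    apply hDB
    refine le_antisymm (divisorClasses_le_hodgeClasses Φ n) ?_
    rw [← hall n, analyticClasses_eq_span Φ e hN, Submodule.span_le]
    rintro _ ⟨Z, hZ, rfl⟩
    exact hno Z hZ
  · rintro ⟨Z, hZ, hZD⟩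
    rcases h.analyticClasses_eq_divisorClasses_or_eq_hodgeClasses Φ e hHg hn with hAD | hAB
    · exact absurd (hAD ▸ analyticCycleClass_mem_analyticClasses Φ e hN hZ) hZD
    · exact (h.forall_analyticClasses_eq_hodgeClasses_iff_weilHodgeCycles_le Φ e hHg hn).2
        (by rw [hAB]; exact h.toIsWeilType.weilHodgeCycles_le_hodgeClasses)

/-- The same with the printed hypothesis `Hg(X) = SU_H(ℝ)`. [cite: vanGeemen1994HodgeAV, Thm. 6.11, Thm. 6.12 and Thm. 4.15]
[cite: Weil1977HodgeRing, Thm.] -/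
theorem IsPolarizedWeilType.forall_analyticClasses_eq_hodgeClasses_iff_of_hodgeGroup_eq
    (h : IsPolarizedWeilType Φ η α d n) (hHg : hodgeGroup Φ = weilSpecialUnitaryGroup Φ η α d n) (hn : 2 ≤ n)
    (hN : 2 * n + 2 * n = N) :
    (∀ p, analyticClasses Φ e p = hodgeClasses Φ p) ↔
      ∃ (Z : Set (ComplexTorus Φ)) (hZ : HasPureDim 𝓘(ℂ, E) Z n), analyticCycleClass Φ e hN hZ ∉ divisorClasses Φ n :=
  h.forall_analyticClasses_eq_hodgeClasses_iff_exists_not_mem_divisorClasses Φ e hHg.ge hn hN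

end General

end ComplexTorus

end Literature.Geometry.Kaehler

end
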